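import Summits.HodgeConjecture.HodgeConjecture.Theorems.K2E1StGlobKitOfLevelCut      -- ★ p855123 (K2E1-p09): `e1St1383Letter_of_levelCut_identity` (+ ★ leaf p854778: `E1St1383Letter`, `Pl`, `HLoc`)
import Summits.HodgeConjecture.HodgeConjecture.Theorems.K2E1ReadOffAtPlaceOfEq1383    -- ★ p855300 (K2E1-p08): `identityAt_of_pinned1383`
import HarnessLib

/-!
# K2·E1 — THE TOP COMPOSITION: ★ `E1St1383Letter` (the type of the tier-0 socket `stub_E1_St1383`) FROM THE PINNED (13.8.3) — `e1St1383Letter_of_pinned1383`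
# = ★ `e1St1383Letter_of_levelCut_identity` (K2E1-p09) ∘ ★ `identityAt_of_pinned1383` (K2E1-p08), with the engine's residue NAMED as four binder-complete hypotheses

Track B ∕ K2-LIT, crux h413 = `stmt-HodgeConjecture-24833`, route of record `HCCMUnconditional`; cell `hodgecm-mathlib`, squad K2; prover seat `hodgecm-mathlib-K2E1-p08` (g0),
BY-NAME DEAL of the dealer K2E1-plan (g0) 2026-09-03T22:31:55Z; lane `--kind definition --supports stmt-HodgeConjecture-24833 --as helper` (count-neutral).  Five definitions
(four hypothesis PREDICATES + one closed letter) + ONE theorem; no instance, no notation, no axiom, no `sorry`.  HONEST LABEL: HC_CM is proved only modulo the 7 printed citations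
(2 remaining named inputs: hLiu418 = `stmt-HodgeConjecture-24832`, h413 = `stmt-HodgeConjecture-24833`) until rung 0 closes; this file closes NO socket: it shows that the tier-0
socket's type follows from the level-cut data plus four NAMED printed equations, nothing else.

## The hypothesis list of `e1St1383Letter_of_pinned1383` (what the dealer's Sigs ED. 9 types as engine-terminal sockets)
Under the letter's prefix VERBATIM (CM `L`, `μ`, `ξ`, non-split `v`, Haar data `νHv νQv`, canonical orbital families `mHv mQv`, the `H_v`-classes `π₁ πSt` with their labels),
`Pinned1383Letter` ∃-binds ONE witness package — an automorphic `μG`; a FINITE level cut `ι` with families `loc i` OCCURRING for `μG`, multiplicities `m i ≥ 1`, signs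
`ε i = ±1` [(G1) globalisation + (G3) pseudo-coefficients + (G4) units; p. 218]; and three GLOBAL TRACE FUNCTIONALS of the frozen test vector `trTw` (twisted side),
`trG i` (`Tr π_i(· ⊗ f^v)`), `trH` (`Tr ρ(· ⊗ (f^v)^H)`) — and asks of it the four predicates of §1 at the tier-0 matching relation
`Match f^H φ := IsLocSmooth f^H ∧ IsLocSmooth φ ∧ IsLocalDeltaTransfer … f^H φ`:
* `PinnedEq1383Hyp L v m Match trTw trG trH` — **(13.8.3) PINNED**: `trTw φ = 2 Σ_i m_i · trG i φ − trH f^H` on matched pairs [display (13.8.3) p. 218; ★ shell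
  `TwistedComparisonData.eq1383_of_laws`, rows 13–17];
* `TwistedSideVanishesHyp L v Match trTw` — **`φ_u = 0`** at the distinguished infinite place ⇒ `Tr(I(φ)I(ε)) = 0` [p. 218 l. −6; rows 16∕17];
* `FlathGHyp L v loc ε νQv Match trG` — **Flath ⊗ on `G` + units + signs**: `trG i φ = ε_i · Tr (loc i)_v(φ)` [row 18; p. 219 l. 1–4];
* `FlathHHyp L v νHv πSt Match trH` — **Flath ⊗ on `H` + `Tr ρ_u(f_u^H) = 2` + units + `ρ_v = St_H(ξ_v)`**: `trH f^H = 2 · Tr πSt(f^H)` [p. 218 l. −5, −2; §4.9].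
WHY NOT FOUR CLOSED `Prop`s: the four share the ∃-bound witness (`ι, loc, m, ε, trTw, trG, trH`) — as separately closed terms they could only be universally quantified over
that data, which is false∕vacuous (the design point of ★ `K2E1PacketRigidityU3Defs`); they become closed statements about CONCRETE objects once rows 13∕14 pin
`trTw trG trH` to the ★ `PureTensor` test spaces and K2E1-p09's `discreteSumG` — until then they are binder-complete PREDICATES and `Pinned1383Letter` is the one closed term.

CONTENTS: §1 the four predicates; §2 `Pinned1383Letter : Prop` (prefix = ★ `E1St1383Letter`'s, token for token); §3 **`e1St1383Letter_of_pinned1383 : Pinned1383Letter → E1St1383Letter`**.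

References: [Rogawski1990] §13.8 Prop. 13.8.3 (proof) pp. 218–219, display (13.8.3); §12.7 Lemma 12.7.2 p. 191; [FlathCorvallis1979] Thm. 3.
GATE NOTE: the docstring of the binder-less `def Pinned1383Letter : Prop` spells its locators `(print: …)` (★ `K2E1TraceFormulaBetaDefs` convention) so the inline-fact relocation
does not lift a route-posited statement over Summits-side vocabulary; predicates and the theorem keep `[cite:]`.
-/

set_option autoImplicit false
-- the mandated namespace repeats the single-problem summit's segment (`HodgeConjecture.HodgeConjecture`)
set_option linter.dupNamespace false

noncomputable section

open NumberField IsDedekindDomain MeasureTheory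
open scoped Matrix MatrixGroups
open Literature.NumberTheory.Rogawski1990 Literature.NumberTheory.Automorphic Literature.NumberTheory.Automorphic.UnitaryGroup
open Literature.NumberTheory.Automorphic.UnitaryGroup.CotangentForms Literature.NumberTheory.GaloisRepresentations
open Literature.NumberTheory.Automorphic.Arthur2013.Leaves.TECR
open Summit.HodgeConjecture.HodgeConjecture.Cruxes.H413.F0P3GlobalPacketDiscrete (cmOccursInDiscreteSpectrum)
open Summit.HodgeConjecture.HodgeConjecture.Cruxes.H413.K2E1TraceFormulaBeta
open Summit.HodgeConjecture.HodgeConjecture.Cruxes.H413.K2E1StGlobKitOfLevelCut (e1St1383Letter_of_levelCut_identity)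
open Summit.HodgeConjecture.HodgeConjecture.Cruxes.H413.K2E1ReadOffAtPlace (identityAt_of_pinned1383)

namespace Summit.HodgeConjecture.HodgeConjecture.Cruxes.H413.K2E1St1383LetterOfPinned

/-! ## §1 The four hypotheses as binder-complete predicates [§13.8 pp. 218–219] -/

section Hyps

variable (L : Type) [Field L] [NumberField L] [IsCMField L] (v : Pl L)

/-- **(13.8.3) PINNED at the frozen test vector**: on matched pairs `(f^H, φ)` at `v`, `Tr(I_{ρ̃′}(φ ⊗ φ^v)I(ε)) = 2 Σ_i m(π_i) Tr π_i(φ ⊗ f^v) − Tr ρ(f^H ⊗ (f^v)^H)` over the finite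
level cut `ι` — as an equation between the three global trace functionals `trTw`, `trG`, `trH`.  Source when built: ★ `TwistedComparisonData.eq1383_of_laws` instantiated on the
concrete test spaces. [cite: Rogawski1990, §13.8 display (13.8.3) p. 218] -/
def PinnedEq1383Hyp {ι : Type} (m : ι → ℕ) (Match : (HLoc L v → ℂ) → (Gqs L v → ℂ) → Prop)
    (trTw : (Gqs L v → ℂ) → ℂ) (trG : ι → (Gqs L v → ℂ) → ℂ) (trH : (HLoc L v → ℂ) → ℂ) : Prop :=
  ∀ (fH : HLoc L v → ℂ) (φ : Gqs L v → ℂ), Match fH φ → trTw φ = 2 * ∑ᶠ i, (m i : ℂ) * trG i φ - trH fH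

/-- **THE TWISTED SIDE VANISHES**: the archimedean component of the twisted test function at the distinguished infinite place is `0` («we can take `φ_u = 0`»), so
`Tr(I(φ)I(ε)) = 0` on every matched pair at `v`. [cite: Rogawski1990, §13.8 p. 218] -/
def TwistedSideVanishesHyp (Match : (HLoc L v → ℂ) → (Gqs L v → ℂ) → Prop) (trTw : (Gqs L v → ℂ) → ℂ) : Prop :=
  ∀ (fH : HLoc L v → ℂ) (φ : Gqs L v → ℂ), Match fH φ → trTw φ = 0

/-- **FLATH ON `G` + UNITS + SIGNS**: `Tr π_i(φ ⊗ f^v) = ε_i · Tr (loc i)_v(φ)` (the off-`v` finite components are unramified with unit test functions, the archimedean factor is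
the sign `ε_i` of the pseudo-coefficients). [cite: Rogawski1990, §13.8 p. 219] [cite: FlathCorvallis1979, Thm. 3] -/
def FlathGHyp {ι : Type} (loc : ι → ∀ u : Pl L, IrrClass (Gqs L u)) (ε : ι → ℤ) [MeasurableSpace (Gqs L v)] (νQv : Measure (Gqs L v))
    (Match : (HLoc L v → ℂ) → (Gqs L v → ℂ) → Prop) (trG : ι → (Gqs L v → ℂ) → ℂ) : Prop :=
  ∀ (i : ι) (fH : HLoc L v → ℂ) (φ : Gqs L v → ℂ), Match fH φ → trG i φ = (ε i : ℂ) * (loc i v).smoothTrace νQv φ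

/-- **FLATH ON `H` + `Tr ρ_u(f_u^H) = 2` + UNITS + `ρ_v = St_H(ξ_v)`**: `Tr ρ(f^H ⊗ (f^v)^H) = 2 · Tr St_H(ξ_v)(f^H)`. [cite: Rogawski1990, §13.8 p. 218] [cite: FlathCorvallis1979, Thm. 3] -/
def FlathHHyp [MeasurableSpace (HLoc L v)] (νHv : Measure (HLoc L v)) (πSt : IrrClass (HLoc L v))
    (Match : (HLoc L v → ℂ) → (Gqs L v → ℂ) → Prop) (trH : (HLoc L v → ℂ) → ℂ) : Prop :=
  ∀ (fH : HLoc L v → ℂ) (φ : Gqs L v → ℂ), Match fH φ → trH fH = 2 * πSt.smoothTrace νHv fH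

end Hyps

/-! ## §2 The pinned-(13.8.3) letter: the level-cut data + the four hypotheses, under the prefix of ★ `E1St1383Letter` -/

/-- **`Pinned1383Letter`** — under the prefix of ★ `E1St1383Letter` TOKEN FOR TOKEN: there are an automorphic measure `μG` on `U(Φ₃)(L⁺)\U(Φ₃)(𝔸_{L⁺})`, a FINITE level cut `ι`
of families `loc i` OCCURRING in the discrete spectrum for `μG` with multiplicities `m i ≥ 1` and signs `ε i = ±1`, and global trace functionals `trTw, trG, trH` of the frozen
test vector, satisfying `PinnedEq1383Hyp` ∧ `TwistedSideVanishesHyp` ∧ `FlathGHyp` ∧ `FlathHHyp` at the tier-0 matching relation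
`IsLocSmooth f^H ∧ IsLocSmooth φ ∧ IsLocalDeltaTransfer … f^H φ`.  (print: Rogawski1990, §13.8 Prop. 13.8.3 (proof) pp. 218–219, display (13.8.3)) (print: FlathCorvallis1979, Thm. 3) -/
def Pinned1383Letter : Prop :=
  ∀ (L : Type) [Field L] [NumberField L] [IsCMField L] (μ : HeckeCharacter L) (ξ : OneDimAutRepH L) (v : Pl L),
      (∀ w : PlacesOver L v, IsCMField.complexConj L • w.1 = w.1) → μ.IsUnitary →
      (∀ x : Literature.NumberTheory.GaloisRepresentations.ideleGroup ↥(maximalRealSubfield L),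
        μ (AdeleRing.ideleBaseChange (↥(maximalRealSubfield L)) L x) = quadraticHeckeCharCM L x) →
      ∀ [MeasurableSpace (HLoc L v)] [BorelSpace (HLoc L v)] [MeasurableSpace (Gqs L v)] [BorelSpace (Gqs L v)]
        (νHv : Measure (HLoc L v)) (νQv : Measure (Gqs L v))
        [νHv.IsHaarMeasure] [νHv.IsMulRightInvariant] [νQv.IsHaarMeasure] [νQv.IsMulRightInvariant],
      letI : ∀ a : HLoc L v, MeasurableSpace (HLoc L v ⧸ Subgroup.centralizer ({a} : Set (HLoc L v))) := fun _ => borel _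
      haveI : ∀ a : HLoc L v, BorelSpace (HLoc L v ⧸ Subgroup.centralizer ({a} : Set (HLoc L v))) := fun _ => ⟨rfl⟩
      letI : ∀ γ : Gqs L v, MeasurableSpace (Gqs L v ⧸ Subgroup.centralizer ({γ} : Set (Gqs L v))) := fun _ => borel _
      haveI : ∀ γ : Gqs L v, BorelSpace (Gqs L v ⧸ Subgroup.centralizer ({γ} : Set (Gqs L v))) := fun _ => ⟨rfl⟩
      ∀ (mHv : OrbitalMeasureFamily (HLoc L v)) (mQv : OrbitalMeasureFamily (Gqs L v)),
        mHv.IsCanonical (IsLocalGRegular L v) νHv →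
        mQv.IsCanonical (fun γ => IsRegularElt (γ.val : GL (Fin 3) (UnitaryGroup.LocalRing L v))) νQv →
        ∀ (π₁ πSt : IrrClass (HLoc L v)),
          HLengthTwoLabels L v
            (torusCharPair (conjLocal L (IsCMField.complexConj L) v) (cmLocalForm L 2 v) (cmLocalForm_eq_over L 2 v) 0
              ((torusLocalComponent L (IsCMField.complexConj L) v ξ.η).comp
                  (quotConj (conjLocal L (IsCMField.complexConj L) v) (conjLocal_conjLocal_cm L v)) *
                halfModulusChar (UnitaryGroup.LocalRing L v))
              (torusLocalComponent L (IsCMField.complexConj L) v ξ.ψ))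
            ((torusLocalComponent L (IsCMField.complexConj L) v ξ.ψ).comp (localDet (IsCMField.complexConj L) v (isUnit_antidiagOne_det L 1))) π₁ πSt →
          (∀ fH : HLoc L v → ℂ, IsLocSmooth fH → π₁.smoothTrace νHv fH = charDist (ξ.xiLocalChar v) νHv fH) →
          ∃ (μG : Measure (adelicGroupData (↥(maximalRealSubfield L)) L (IsCMField.complexConj L) 3 (qsForm L)).automorphicQuotient)
            (_ : (adelicGroupData (↥(maximalRealSubfield L)) L (IsCMField.complexConj L) 3 (qsForm L)).IsAutomorphicMeasure μG)
            (ι : Type) (_ : Finite ι) (loc : ι → ∀ u : Pl L, IrrClass (Gqs L u)) (m : ι → ℕ) (ε : ι → ℤ)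
            (trTw : (Gqs L v → ℂ) → ℂ) (trG : ι → (Gqs L v → ℂ) → ℂ) (trH : (HLoc L v → ℂ) → ℂ),
            (∀ i, cmOccursInDiscreteSpectrum L 3 (qsForm L) μG (loc i) ∧ 0 < m i) ∧ (∀ i, ε i = 1 ∨ ε i = -1) ∧
            PinnedEq1383Hyp L v m (fun (fH : HLoc L v → ℂ) (φ : Gqs L v → ℂ) => IsLocSmooth fH ∧ IsLocSmooth φ ∧
              IsLocalDeltaTransfer L (qsForm L) v ((finExplicitCollection L (qsForm L) μ (finExplicitDelta_conj_left_all L (qsForm L) μ) (finExplicitDelta_conj_right_all L (qsForm L) μ)) v) mHv mQv fH φ) trTw trG trH ∧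
            TwistedSideVanishesHyp L v (fun (fH : HLoc L v → ℂ) (φ : Gqs L v → ℂ) => IsLocSmooth fH ∧ IsLocSmooth φ ∧
              IsLocalDeltaTransfer L (qsForm L) v ((finExplicitCollection L (qsForm L) μ (finExplicitDelta_conj_left_all L (qsForm L) μ) (finExplicitDelta_conj_right_all L (qsForm L) μ)) v) mHv mQv fH φ) trTw ∧
            FlathGHyp L v loc ε νQv (fun (fH : HLoc L v → ℂ) (φ : Gqs L v → ℂ) => IsLocSmooth fH ∧ IsLocSmooth φ ∧
              IsLocalDeltaTransfer L (qsForm L) v ((finExplicitCollection L (qsForm L) μ (finExplicitDelta_conj_left_all L (qsForm L) μ) (finExplicitDelta_conj_right_all L (qsForm L) μ)) v) mHv mQv fH φ) trG ∧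
            FlathHHyp L v νHv πSt (fun (fH : HLoc L v → ℂ) (φ : Gqs L v → ℂ) => IsLocSmooth fH ∧ IsLocSmooth φ ∧
              IsLocalDeltaTransfer L (qsForm L) v ((finExplicitCollection L (qsForm L) μ (finExplicitDelta_conj_left_all L (qsForm L) μ) (finExplicitDelta_conj_right_all L (qsForm L) μ)) v) mHv mQv fH φ) trH

/-! ## §3 The top composition -/

/-- **★ `E1St1383Letter` FROM THE PINNED (13.8.3)** — the tier-0 socket's TYPE follows from `Pinned1383Letter`: unpack the witness package, read the identity at `v` off the four
hypotheses (★ `identityAt_of_pinned1383`), and feed the level-cut letter (★ `e1St1383Letter_of_levelCut_identity`, whose kit laws are bookkeeping).  So the monolithic debt behind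
`stub_E1_St1383` is EXACTLY: (G1)+(G3)+(G4) data (`μG`, finite occurring level cut, `m ≥ 1`, `ε = ±1`) and the four named printed equations.
[cite: Rogawski1990, §13.8 Prop. 13.8.3 (proof) pp. 218–219, display (13.8.3); §12.7 Lemma 12.7.2 p. 191] [cite: FlathCorvallis1979, Thm. 3] -/
theorem e1St1383Letter_of_pinned1383 (h : Pinned1383Letter) : E1St1383Letter := by
  refine e1St1383Letter_of_levelCut_identity ?_
  intro L _ _ _ μ ξ v hv hμu hμq _ _ _ _ νHv νQv _ _ _ _ mHv mQv hmH hmQ π₁ πSt hlab hπ₁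
  obtain ⟨μG, hμG, ι, hι, loc, m, ε, trTw, trG, trH, hocc, hε, hEq, hTw, hG, hH⟩ :=
    h L μ ξ v hv hμu hμq νHv νQv mHv mQv hmH hmQ π₁ πSt hlab hπ₁
  refine ⟨μG, hμG, ι, hι, loc, m, ε, hocc, hε, fun fH φ hfH hφ htr => ?_⟩
  exact identityAt_of_pinned1383 v loc m ε νQv νHv πSt _ trTw trG trH hEq hTw hG hH fH φ ⟨hfH, hφ, htr⟩

end Summit.HodgeConjecture.HodgeConjecture.Cruxes.H413.K2E1St1383LetterOfPinned

end
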